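import Summits.AtomisticToContinuum.HydrodynamicLimit.Theorems.CollisionIsometryCLTCollisionalTransferLocalityWeightedKineticRelaxation
import Summits.AtomisticToContinuum.HydrodynamicLimit.Theorems.CollisionIsometryCLTCollisionalTransferLocalityDefsB
import HarnessLib

/-!
# Floor-free, exponential-moment-free `(Z−1)`-weighted weak kinetic relaxation [C]°
(registered stub `stub_weightedKineticRelaxationDilute`)

Stub [C]° of the line `hemisphere-affine-slaving` for the crux `CollisionalTransferLocality`
(stmt-AtomisticToContinuum-9518): the EOS-free rework of the landed [C]
`stub_weightedKineticRelaxation`. Given constants `η_Z > 0`, `K ≥ 0` with `|Z(η) − 1| ≤ K η` on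
`[0, η_Z]`, a dilute level `0 < η₁ ≤ η_Z`, `σ > 0`, profiles, a flow family, a horizon `t > 0` with an
energy cap `E₀` (w.h.p. `(N+1)⁻¹ E(Φ_s z) ≤ E₀` for all `s ≤ t`), an admissible kernel family with the
dilute event `DiluteAt … η₁` (w.h.p. `ρ̄σ³ ≤ η₁` on `[0, t] × 𝕋³`), and the kinetic closure at this
`(Φ, kernel, t)` (`∫₀ᵗ∫ ΣD² + |q|² → 0` in probability), for all smooth tests: `RelaxC`, i.e.
`K_N(z, τ) = ∫₀^τ∫ kinW · p_c(ρ̄, θ̄) → 0` in local-Gibbs probability uniformly in `τ ≤ t`.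

Estimate (replacing the floor `c₁ ≤ ρ̄`, the convexity bound `|Z − 1| ≤ C_Z` and the exponential
moments of the landed [C]): `|kinW · p_c| ≤ (|S₁| + |S₂| + |S₃|)|Z(ρ̄σ³) − 1|` (`abs_kinW_mul_pcoll_le`)
with `|Z(ρ̄σ³) − 1| ≤ K ρ̄σ³ ≤ K η₁` (`0 ≤ ρ̄σ³ ≤ η₁ ≤ η_Z`); `S₁ = D:∇ψ` and `S₃ = q·∇χ` are priced by
AM–GM as before, and `S₂ = Σ D_ab ū_b ∂_aχ` by `|D_ab| · |ū_b| K ρ̄σ³ ≤ P/ε + ε K²σ⁶ ρ̄²|ū|²` with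
`ρ̄²|ū|² ≤ 2ρ̄Ē` (weighted Cauchy–Schwarz), whence
`|kinW · p_c| ≤ C_t [12Kη₁ ε + 18 ε K²σ³η₁ Ē + (12Kη₁ + 9) ε⁻¹ (ΣD² + |q|²)]`;
`∫ₓ Ē = (N+1)⁻¹ E` is conserved along good orbits and capped by `E₀` off the energy event; choosing
`ε`, then the closure level `δ'`, from `δ` gives `sup_τ |K_N| ≤ 2δ/3` on the good set off the three bad
events (dilute, energy, closure); union bound and squeeze. Sources: Chapman–Cowling 1970 §16.4;
Spohn 1991 I §3.
-/

namespace Summit.AtomisticToContinuum.HydrodynamicLimit.Theorems.HemisphereAffineSlaving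

open scoped BigOperators Topology Classical MeasureTheory ENNReal
open Filter Set Function TopologicalSpace MeasureTheory

noncomputable section

open Literature.MathematicalPhysics.KineticTheory (T3 V3 hsCompressibility hsPressure localGibbsLaw)
open Literature.Analysis.FluidPDE (empiricalMeasure integral_empiricalMeasure configEnergy)

variable {N : ℕ}

/-! ## (CS)° The floor-free pointwise bound on the integrand of `K_N` -/

/-- `ρ̄² |ū|² ≤ 2 ρ̄ Ē` for a nonnegative kernel (weighted Cauchy–Schwarz `|m̄|² ≤ 2ρ̄Ē`; on an empty
block both sides vanish). [folklore] -/
theorem rhoB_sq_mul_norm_uB_sq_le {φ : ℕ → T3 → ℝ} {w : Cfg N} {x : T3} (hφ0 : ∀ y, 0 ≤ φ N y) :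
    rhoB φ N w x ^ 2 * ‖uB φ N w x‖ ^ 2 ≤ 2 * rhoB φ N w x * EB φ N w x := by
  rcases (rhoB_nonneg (w := w) (x := x) hφ0).lt_or_eq with hρ | hρ
  · have h := norm_uB_sq_le (w := w) (x := x) hφ0 hρ
    rw [le_div_iff₀ hρ] at h
    calc rhoB φ N w x ^ 2 * ‖uB φ N w x‖ ^ 2
        = rhoB φ N w x * (‖uB φ N w x‖ ^ 2 * rhoB φ N w x) := by ring
      _ ≤ rhoB φ N w x * (2 * EB φ N w x) := mul_le_mul_of_nonneg_left h hρ.le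
      _ = 2 * rhoB φ N w x * EB φ N w x := by ring
  · rw [← hρ]; simp

/-- **(CS)° pointwise.** On a block with `ρ̄σ³ ≤ η₁`, for `|Z(η) − 1| ≤ K η` on `[0, η₁]`, test gradients
`≤ C_t` and every `ε > 0`:
`|kinW · p_c| ≤ C_t [12Kη₁ ε + 18 ε K²σ³η₁ Ē + (12Kη₁ + 9) ε⁻¹ (ΣD² + |q|²)]`
(AM–GM; `|Z − 1| ≤ Kρ̄σ³`, `ρ̄²|ū|² ≤ 2ρ̄Ē`; no density floor). [folklore] -/
theorem abs_integrand_dilute_le {ψ : ℝ → T3 → V3} {χ : ℝ → T3 → ℝ} {φ : ℕ → T3 → ℝ} {s : ℝ}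
    {w : Cfg N} {x : T3} {σ K η₁ Ct ε : ℝ} (hφ0 : ∀ y, 0 ≤ φ N y) (hσ : 0 < σ) (hK : 0 ≤ K)
    (hε : 0 < ε) (hCt : 0 ≤ Ct)
    (hZ : ∀ η : ℝ, 0 ≤ η → η ≤ η₁ → |hsCompressibility η - 1| ≤ K * η)
    (hψ : ∀ a b, |gradPsi ψ s x a b| ≤ Ct) (hχ : ∀ a, |gradChi χ s x a| ≤ Ct)
    (hhi : rhoB φ N w x * σ ^ 3 ≤ η₁) :
    |kinW ψ χ φ N s w x * pcoll σ (rhoB φ N w x) (thetaB φ N w x)| ≤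
      Ct * (12 * K * η₁ * ε) + Ct * (18 * ε * K ^ 2 * σ ^ 3 * η₁) * EB φ N w x +
        Ct * ((12 * K * η₁ + 9) / ε) * ((∑ j, ∑ k, Dst φ N w x j k ^ 2) + ‖qfl φ N w x‖ ^ 2) := by
  have hρ0 : 0 ≤ rhoB φ N w x := rhoB_nonneg hφ0
  have hη0 : 0 ≤ rhoB φ N w x * σ ^ 3 := by positivity
  have hη₁0 : 0 ≤ η₁ := hη0.trans hhi
  have hE0 : 0 ≤ EB φ N w x := EB_nonneg hφ0
  set Kr := K * (rhoB φ N w x * σ ^ 3) with hKr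
  have hKr0 : 0 ≤ Kr := by positivity
  have hZm : |hsCompressibility (rhoB φ N w x * σ ^ 3) - 1| ≤ Kr := hZ _ hη0 hhi
  have hKrle : Kr ≤ K * η₁ := mul_le_mul_of_nonneg_left hhi hK
  set Pf := ((∑ j, ∑ k, Dst φ N w x j k ^ 2) + ‖qfl φ N w x‖ ^ 2) with hPf
  have hP0 : 0 ≤ Pf := by positivity
  have hDsq : ∀ a b, Dst φ N w x a b ^ 2 ≤ Pf := fun a b => by
    calc Dst φ N w x a b ^ 2 ≤ ∑ k, Dst φ N w x a k ^ 2 :=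
          Finset.single_le_sum (f := fun k => Dst φ N w x a k ^ 2) (fun k _ => sq_nonneg _)
            (Finset.mem_univ b)
      _ ≤ ∑ j, ∑ k, Dst φ N w x j k ^ 2 :=
          Finset.single_le_sum (f := fun j => ∑ k, Dst φ N w x j k ^ 2)
            (fun j _ => Finset.sum_nonneg fun k _ => sq_nonneg _) (Finset.mem_univ a)
      _ ≤ Pf := le_add_of_nonneg_right (sq_nonneg _)
  have hqsq : ∀ a, qfl φ N w x a ^ 2 ≤ Pf := fun a => (sq_apply_le_norm_sq _ a).trans
    (le_add_of_nonneg_left (by positivity))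
  -- the momentum pricing: `(ū_b K ρ̄σ³)² ≤ 2 K² σ³ η₁ Ē`
  have hu2 : ∀ b, (uB φ N w x b * Kr) ^ 2 ≤ 2 * K ^ 2 * σ ^ 3 * η₁ * EB φ N w x := fun b => by
    have h3 := rhoB_sq_mul_norm_uB_sq_le (w := w) (x := x) hφ0
    calc (uB φ N w x b * Kr) ^ 2 ≤ ‖uB φ N w x‖ ^ 2 * Kr ^ 2 := by
          rw [mul_pow]; exact mul_le_mul_of_nonneg_right (sq_apply_le_norm_sq _ b) (sq_nonneg _)
      _ = K ^ 2 * (σ ^ 3) ^ 2 * (rhoB φ N w x ^ 2 * ‖uB φ N w x‖ ^ 2) := by rw [hKr]; ring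
      _ ≤ K ^ 2 * (σ ^ 3) ^ 2 * (2 * rhoB φ N w x * EB φ N w x) :=
          mul_le_mul_of_nonneg_left h3 (by positivity)
      _ = 2 * K ^ 2 * σ ^ 3 * (rhoB φ N w x * σ ^ 3) * EB φ N w x := by ring
      _ ≤ 2 * K ^ 2 * σ ^ 3 * η₁ * EB φ N w x :=
          mul_le_mul_of_nonneg_right (mul_le_mul_of_nonneg_left hhi (by positivity)) hE0
  -- the three sums
  have h1 : |∑ a, ∑ b, Dst φ N w x a b * gradPsi ψ s x a b| ≤ 9 * ((ε + Pf / ε) * Ct) := by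
    calc |∑ a, ∑ b, Dst φ N w x a b * gradPsi ψ s x a b|
        ≤ ∑ a, ∑ b, |Dst φ N w x a b * gradPsi ψ s x a b| :=
          (Finset.abs_sum_le_sum_abs _ _).trans (Finset.sum_le_sum fun a _ =>
            Finset.abs_sum_le_sum_abs _ _)
      _ ≤ ∑ _a : Fin 3, ∑ _b : Fin 3, (ε + Pf / ε) * Ct := by
          refine Finset.sum_le_sum fun a _ => Finset.sum_le_sum fun b _ => ?_
          rw [abs_mul]
          exact mul_le_mul (abs_le_eps hε (hDsq a b)) (hψ a b) (abs_nonneg _) (by positivity)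
      _ = 9 * ((ε + Pf / ε) * Ct) := by simp [Finset.sum_const]; ring
  have h2 : |∑ a, ∑ b, Dst φ N w x a b * uB φ N w x b * gradChi χ s x a| * Kr ≤
      9 * ((Pf / ε + ε * (2 * K ^ 2 * σ ^ 3 * η₁ * EB φ N w x)) * Ct) := by
    calc |∑ a, ∑ b, Dst φ N w x a b * uB φ N w x b * gradChi χ s x a| * Kr
        ≤ (∑ a, ∑ b, |Dst φ N w x a b * uB φ N w x b * gradChi χ s x a|) * Kr :=
          mul_le_mul_of_nonneg_right ((Finset.abs_sum_le_sum_abs _ _).trans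
            (Finset.sum_le_sum fun a _ => Finset.abs_sum_le_sum_abs _ _)) hKr0
      _ = ∑ a, ∑ b, |Dst φ N w x a b| * |uB φ N w x b * Kr| * |gradChi χ s x a| := by
          rw [Finset.sum_mul]
          refine Finset.sum_congr rfl fun a _ => ?_
          rw [Finset.sum_mul]
          refine Finset.sum_congr rfl fun b _ => ?_
          rw [abs_mul, abs_mul, abs_mul, abs_of_nonneg hKr0]
          ring
      _ ≤ ∑ _a : Fin 3, ∑ _b : Fin 3, (Pf / ε + ε * (2 * K ^ 2 * σ ^ 3 * η₁ * EB φ N w x)) * Ct := by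
          refine Finset.sum_le_sum fun a _ => Finset.sum_le_sum fun b _ => ?_
          refine mul_le_mul ((abs_mul_abs_le_eps hε (hDsq a b)).trans ?_) (hχ a) (abs_nonneg _)
            (by positivity)
          exact add_le_add le_rfl (mul_le_mul_of_nonneg_left (hu2 b) hε.le)
      _ = 9 * ((Pf / ε + ε * (2 * K ^ 2 * σ ^ 3 * η₁ * EB φ N w x)) * Ct) := by
          simp [Finset.sum_const]; ring
  have h3 : |∑ a, qfl φ N w x a * gradChi χ s x a| ≤ 3 * ((ε + Pf / ε) * Ct) := by
    calc |∑ a, qfl φ N w x a * gradChi χ s x a| ≤ ∑ a, |qfl φ N w x a * gradChi χ s x a| :=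
          Finset.abs_sum_le_sum_abs _ _
      _ ≤ ∑ _a : Fin 3, (ε + Pf / ε) * Ct := by
          refine Finset.sum_le_sum fun a _ => ?_
          rw [abs_mul]
          exact mul_le_mul (abs_le_eps hε (hqsq a)) (hχ a) (abs_nonneg _) (by positivity)
      _ = 3 * ((ε + Pf / ε) * Ct) := by simp [Finset.sum_const]
  refine (abs_kinW_mul_pcoll_le ψ χ φ s w x σ).trans ?_
  calc (|∑ a, ∑ b, Dst φ N w x a b * gradPsi ψ s x a b| +
        |∑ a, ∑ b, Dst φ N w x a b * uB φ N w x b * gradChi χ s x a| +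
        |∑ a, qfl φ N w x a * gradChi χ s x a|) * |hsCompressibility (rhoB φ N w x * σ ^ 3) - 1|
      ≤ (|∑ a, ∑ b, Dst φ N w x a b * gradPsi ψ s x a b| +
        |∑ a, ∑ b, Dst φ N w x a b * uB φ N w x b * gradChi χ s x a| +
        |∑ a, qfl φ N w x a * gradChi χ s x a|) * Kr :=
        mul_le_mul_of_nonneg_left hZm (by positivity)
    _ = |∑ a, ∑ b, Dst φ N w x a b * gradPsi ψ s x a b| * Kr +
        |∑ a, ∑ b, Dst φ N w x a b * uB φ N w x b * gradChi χ s x a| * Kr +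
        |∑ a, qfl φ N w x a * gradChi χ s x a| * Kr := by ring
    _ ≤ 9 * ((ε + Pf / ε) * Ct) * (K * η₁) +
        9 * ((Pf / ε + ε * (2 * K ^ 2 * σ ^ 3 * η₁ * EB φ N w x)) * Ct) +
        3 * ((ε + Pf / ε) * Ct) * (K * η₁) :=
        add_le_add_three (mul_le_mul h1 hKrle hKr0 (by positivity)) h2
          (mul_le_mul h3 hKrle hKr0 (by positivity))
    _ = _ := by rw [hPf]; ring

/-! ## Integration in `x` and in `s` -/

/-- `x`-integration of the floor-free pointwise bound:
`‖∫ₓ kinW·p_c‖ ≤ A + B (N+1)⁻¹E_kin + C ∫ₓ(ΣD² + |q|²)` with `A = 12 C_t K η₁ ε`,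
`B = 18 C_t ε K²σ³η₁`, `C = C_t (12Kη₁ + 9)/ε` (honest dominating integrand: `Ē` continuous,
`ΣD² + |q|²` measurable and bounded; `∫ₓ Ē = (N+1)⁻¹ E_kin`). [folklore] -/
theorem norm_integral_integrand_dilute_le {ψ : ℝ → T3 → V3} {χ : ℝ → T3 → ℝ} {φ : ℕ → T3 → ℝ}
    {s : ℝ} {w : Cfg N} {σ K η₁ Ct ε Φb : ℝ} (hφc : Continuous (φ N)) (hφ0 : ∀ y, 0 ≤ φ N y)
    (hφ1 : ∫ y, φ N y = 1) (hφb : ∀ y, φ N y ≤ Φb) (hσ : 0 < σ) (hK : 0 ≤ K) (hε : 0 < ε)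
    (hCt : 0 ≤ Ct) (hZ : ∀ η : ℝ, 0 ≤ η → η ≤ η₁ → |hsCompressibility η - 1| ≤ K * η)
    (hψ : ∀ x a b, |gradPsi ψ s x a b| ≤ Ct) (hχ : ∀ x a, |gradChi χ s x a| ≤ Ct)
    (hhi : ∀ x, rhoB φ N w x * σ ^ 3 ≤ η₁) :
    ‖∫ x, kinW ψ χ φ N s w x * pcoll σ (rhoB φ N w x) (thetaB φ N w x)‖ ≤
      Ct * (12 * K * η₁ * ε) +
        Ct * (18 * ε * K ^ 2 * σ ^ 3 * η₁) * (((N + 1 : ℕ) : ℝ)⁻¹ * configEnergy w) +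
        Ct * ((12 * K * η₁ + 9) / ε) *
          ∫ x, ((∑ j, ∑ k, Dst φ N w x j k ^ 2) + ‖qfl φ N w x‖ ^ 2) := by
  set Vb : ℝ := ∑ i, ‖(w i).2‖ with hVb_def
  have hVb : 0 ≤ Vb := Finset.sum_nonneg fun i _ => norm_nonneg _
  have hV : ∀ i, ‖(w i).2‖ ≤ Vb := fun i =>
    Finset.single_le_sum (f := fun i => ‖(w i).2‖) (fun i _ => norm_nonneg _) (Finset.mem_univ i)
  have hPint : Integrable (fun x => ((∑ j, ∑ k, Dst φ N w x j k ^ 2) + ‖qfl φ N w x‖ ^ 2)) := by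
    refine Integrable.mono' (integrable_const (9 * (8 * Φb * Vb ^ 2) ^ 2 + (4 * Φb * Vb ^ 3) ^ 2))
      ((measurable_kineticIntegrand φ N hφc).comp
        (measurable_const.prodMk measurable_id)).aestronglyMeasurable
      (ae_of_all _ fun x => ?_)
    rw [Real.norm_eq_abs, abs_of_nonneg (by positivity)]
    exact kineticIntegrand_le hφ0 hφb hVb hV
  have hEint : Integrable (fun x => EB φ N w x) :=
    ((continuous_EB hφc).comp (continuous_const.prodMk continuous_id)).integrable_unitAddTorus
  set A := Ct * (12 * K * η₁ * ε) with hA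
  set B := Ct * (18 * ε * K ^ 2 * σ ^ 3 * η₁) with hB
  set Cc := Ct * ((12 * K * η₁ + 9) / ε) with hCc
  have hgi : Integrable (fun x => A + B * EB φ N w x +
      Cc * ((∑ j, ∑ k, Dst φ N w x j k ^ 2) + ‖qfl φ N w x‖ ^ 2)) :=
    ((integrable_const _).add (hEint.const_mul _)).add (hPint.const_mul _)
  refine (norm_integral_le_of_norm_le hgi (ae_of_all _ fun x => ?_)).trans (le_of_eq ?_)
  · rw [Real.norm_eq_abs]
    exact abs_integrand_dilute_le hφ0 hσ hK hε hCt hZ (hψ x) (hχ x) (hhi x)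
  · have hi1 : Integrable (fun x => A + B * EB φ N w x) :=
      (integrable_const _).add (hEint.const_mul _)
    rw [integral_add hi1 (hPint.const_mul _), integral_add (integrable_const _) (hEint.const_mul _),
      integral_const, integral_const_mul, integral_const_mul, integral_EB hφc hφ1]
    simp

section OrbitD

variable {σ : ℝ} (Φ : Flows σ) {z : Cfg N} (hz : z ∈ (Φ N).good)
include hz

/-- **The pathwise bound on `K_N`** on a good orbit with `ρ̄σ³ ≤ η₁` on `[0, t] × 𝕋³`, test gradients
`≤ C_t`, `|Z(η) − 1| ≤ Kη` on `[0, η₁]`, `ε > 0`, `τ ≤ t`: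
`|K_N(z, τ)| ≤ (A + B (N+1)⁻¹E_kin(z)) t + C ∫₀ᵗ∫ₓ (ΣD² + |q|²)` with `A = 12 C_t K η₁ ε`,
`B = 18 C_t ε K²σ³η₁`, `C = C_t (12Kη₁ + 9)/ε` (energy conservation along the orbit). [folklore] -/
theorem abs_Kfun_dilute_le {ψ : ℝ → T3 → V3} {χ : ℝ → T3 → ℝ} {φ : ℕ → T3 → ℝ}
    {t K η₁ Ct ε Φb : ℝ} (hφc : Continuous (φ N)) (hφ0 : ∀ y, 0 ≤ φ N y) (hφ1 : ∫ y, φ N y = 1)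
    (hφb : ∀ y, φ N y ≤ Φb) (hσ : 0 < σ) (hK : 0 ≤ K) (hη₁ : 0 ≤ η₁) (hε : 0 < ε) (hCt : 0 ≤ Ct)
    (hZ : ∀ η : ℝ, 0 ≤ η → η ≤ η₁ → |hsCompressibility η - 1| ≤ K * η)
    (hψ : ∀ s ∈ Icc 0 t, ∀ x a b, |gradPsi ψ s x a b| ≤ Ct)
    (hχ : ∀ s ∈ Icc 0 t, ∀ x a, |gradChi χ s x a| ≤ Ct)
    (hhi : ∀ s ∈ Icc 0 t, ∀ x, rhoB φ N ((Φ N).flow s z) x * σ ^ 3 ≤ η₁) {τ : ℝ}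
    (hτ : τ ∈ Icc 0 t) :
    |Kfun σ Φ φ ψ χ N z τ| ≤
      (Ct * (12 * K * η₁ * ε) +
          Ct * (18 * ε * K ^ 2 * σ ^ 3 * η₁) * (((N + 1 : ℕ) : ℝ)⁻¹ * configEnergy z)) * t +
        Ct * ((12 * K * η₁ + 9) / ε) *
          ∫ s in Icc 0 t, ∫ x, ((∑ j, ∑ k, Dst φ N ((Φ N).flow s z) x j k ^ 2) +
            ‖qfl φ N ((Φ N).flow s z) x‖ ^ 2) := by
  set A := Ct * (12 * K * η₁ * ε) +
    Ct * (18 * ε * K ^ 2 * σ ^ 3 * η₁) * (((N + 1 : ℕ) : ℝ)⁻¹ * configEnergy z) with hA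
  set Cc := Ct * ((12 * K * η₁ + 9) / ε) with hCc
  set G : ℝ → ℝ := fun s =>
    ∫ x, ((∑ j, ∑ k, Dst φ N ((Φ N).flow s z) x j k ^ 2) + ‖qfl φ N ((Φ N).flow s z) x‖ ^ 2) with hG
  have hE0 : 0 ≤ configEnergy z := by unfold configEnergy; positivity
  have hA0 : 0 ≤ A := by positivity
  have hCc0 : 0 ≤ Cc := by positivity
  have hVb : 0 ≤ Real.sqrt (2 * configEnergy z) := Real.sqrt_nonneg _
  have hG0 : ∀ s, 0 ≤ G s := fun s => integral_nonneg fun x => by positivity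
  have hGm : Measurable G := by
    have hg : Measurable fun q : ℝ × T3 => (((Φ N).flow q.1 z, q.2) : Cfg N × T3) :=
      ((measurable_orbit Φ hz).comp measurable_fst).prodMk measurable_snd
    have hj : Measurable ((fun p : Cfg N × T3 =>
        ((∑ j, ∑ k, Dst φ N p.1 p.2 j k ^ 2) + ‖qfl φ N p.1 p.2‖ ^ 2)) ∘
        fun q : ℝ × T3 => (((Φ N).flow q.1 z, q.2) : Cfg N × T3)) :=
      (measurable_kineticIntegrand φ N hφc).comp hg
    exact hj.stronglyMeasurable.integral_prod_right'.measurable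
  set M : ℝ := 9 * (8 * Φb * Real.sqrt (2 * configEnergy z) ^ 2) ^ 2 +
    (4 * Φb * Real.sqrt (2 * configEnergy z) ^ 3) ^ 2 with hM
  have hGb : ∀ s, ‖G s‖ ≤ M := fun s => by
    refine (norm_integral_le_of_norm_le (integrable_const M) (ae_of_all _ fun x => ?_)).trans ?_
    · rw [Real.norm_eq_abs, abs_of_nonneg (by positivity)]
      exact kineticIntegrand_le hφ0 hφb hVb (norm_vel_orbit_le Φ hz s)
    · simp
  have hGi : IntegrableOn G (Icc 0 t) :=
    Measure.integrableOn_of_bounded measure_Icc_lt_top.ne hGm.aestronglyMeasurable (ae_of_all _ hGb)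
  have hBi : IntegrableOn (fun s => A + Cc * G s) (Icc 0 t) :=
    (integrableOn_const measure_Icc_lt_top.ne).add (hGi.const_mul Cc)
  have ht0 : 0 ≤ t := hτ.1.trans hτ.2
  unfold Kfun
  rw [← Real.norm_eq_abs]
  calc ‖∫ s in Icc 0 τ, ∫ x, kinW ψ χ φ N s ((Φ N).flow s z) x *
        pcoll σ (rhoB φ N ((Φ N).flow s z) x) (thetaB φ N ((Φ N).flow s z) x)‖
      ≤ ∫ s in Icc 0 τ, (A + Cc * G s) := by
        refine norm_integral_le_of_norm_le (hBi.mono_set (Icc_subset_Icc_right hτ.2))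
          (ae_restrict_of_forall_mem measurableSet_Icc fun s hs => ?_)
        have hs' : s ∈ Icc 0 t := ⟨hs.1, hs.2.trans hτ.2⟩
        have h := norm_integral_integrand_dilute_le hφc hφ0 hφ1 hφb hσ hK hε hCt hZ (hψ s hs')
          (hχ s hs') (hhi s hs') (ψ := ψ) (χ := χ)
        rwa [configEnergy_orbit Φ hz s] at h
    _ ≤ ∫ s in Icc 0 t, (A + Cc * G s) :=
        setIntegral_mono_set hBi (ae_of_all _ fun s => add_nonneg hA0 (mul_nonneg hCc0 (hG0 s)))
          (Icc_subset_Icc_right hτ.2).eventuallyLE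
    _ = A * t + Cc * ∫ s in Icc 0 t, G s := by
        have hAi : IntegrableOn (fun _ : ℝ => A) (Icc 0 t) :=
          integrableOn_const measure_Icc_lt_top.ne
        rw [integral_add hAi (hGi.const_mul Cc), setIntegral_const, integral_const_mul]
        simp [Measure.real, Real.volume_Icc, ht0, mul_comm]

end OrbitD

/-! ## The registered stub -/

/-- **Registered stub `stub_weightedKineticRelaxationDilute`** ([C]°, the FLOOR-FREE /
EXPONENTIAL-MOMENT-FREE `(Z−1)`-weighted weak kinetic relaxation) of crux
stmt-AtomisticToContinuum-9518 (line hemisphere-affine-slaving): given `η_Z > 0`, `K ≥ 0` with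
`|Z(η) − 1| ≤ K η` on `[0, η_Z]`, a dilute level `0 < η₁ ≤ η_Z`, `σ > 0`, profiles, a flow family, a
horizon `t > 0` with an energy cap `E₀` (w.h.p.), an admissible kernel family with the dilute event
`DiluteAt … η₁` and the kinetic closure at this `(Φ, kernel, t)`, for all smooth tests: `RelaxC` —
`K_N(z, τ) → 0` in local-Gibbs probability uniformly in `τ ≤ t` (on the good set off the dilute /
energy / closure bad events `sup_τ |K_N| ≤ 2δ/3` by `abs_Kfun_dilute_le` with `ε`, `δ'` chosen from
`δ`; union bound). [folklore] -/
theorem stub_weightedKineticRelaxationDilute : ∀ (ηZ K : ℝ), 0 < ηZ → 0 ≤ K → (∀ η : ℝ, 0 ≤ η → η ≤ ηZ → |Literature.MathematicalPhysics.KineticTheory.hsCompressibility η - 1| ≤ K * η) → ∀ η₁ : ℝ, 0 < η₁ → η₁ ≤ ηZ → ∀ σ : ℝ, 0 < σ → ∀ (a₀ θ₀ : T3 → ℝ) (u₀ : T3 → V3) (Φ : Flows σ) (t E₀ : ℝ), 0 < t → Tendsto (fun N : ℕ => Literature.MathematicalPhysics.KineticTheory.localGibbsLaw σ a₀ u₀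 θ₀ N (Φ N) {z | ∃ s ∈ Icc 0 t, E₀ < ((N : ℝ) + 1)⁻¹ * Literature.Analysis.FluidPDE.configEnergy ((Φ N).flow s z)}) atTop (𝓝 0) → ∀ (γ C : ℝ) (φ : ℕ → T3 → ℝ), 0 < γ → γ ≤ 1 / 15 → AdmissibleKernel γ C φ → DiluteAt σ a₀ θ₀ u₀ Φ t φ η₁ → (∀ δ : ℝ, 0 < δ → Tendsto (fun N : ℕ => Literature.MathematicalPhysics.KineticTheory.localGibbsLaw σ a₀ u₀ θ₀ N (Φ N) {z | δ < ∫ s in Icc 0 t, ∫ x, ((∑ j, ∑ k, Dst φ N ((Φ N).flow s z) x j k ^ 2) + ‖qfl φ N ((Φ N).flow s z) x‖ ^ 2)}) atTop (𝓝 0)) → ∀ (ψ : ℝ → T3 → V3) (χ : ℝ → T3 → ℝ), Literature.Analysis.FunctionSpaces.Torus.IsSmoothSpaceTimeOn (Icc 0 t) ψ → Literature.Analysis.FunctionSpaces.Torus.IsSmoothSpaceTimeOn (Icc 0 t) χ → RelaxC σ a₀ θ₀ u₀ Φ φ t ψ χ := by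
  intro ηZ K _hηZ hK hZ η₁ hη₁ hη₁Z σ hσ a₀ θ₀ u₀ Φ t E₀ ht hEcap γ C φ _hγ _hγ' hadm hDil hFMR ψ χ
    hψ hχ δ hδ
  have hZ' : ∀ η : ℝ, 0 ≤ η → η ≤ η₁ → |hsCompressibility η - 1| ≤ K * η := fun η h0 h1 =>
    hZ η h0 (h1.trans hη₁Z)
  obtain ⟨Ct, hCt0, hCtψ, hCtχ⟩ := exists_grad_bound ht hψ hχ
  set Kc : ℝ := Ct + 1 with hKc
  have hKc0 : 0 < Kc := by positivity
  set A₀ : ℝ := (12 * K * η₁ + 18 * K ^ 2 * σ ^ 3 * η₁ * |E₀|) * t + 1 with hA₀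
  have hA₀0 : 0 < A₀ := by positivity
  have hL0 : 0 < 12 * K * η₁ + 9 := by positivity
  set ε : ℝ := δ / (3 * Kc * A₀) with hε
  have hε0 : 0 < ε := by positivity
  set δ' : ℝ := δ * ε / (3 * Kc * (12 * K * η₁ + 9)) with hδ'
  have hδ'0 : 0 < δ' := by positivity
  have hF : Tendsto (fun N : ℕ => localGibbsLaw σ a₀ u₀ θ₀ N (Φ N)
      {z | δ' < ∫ s in Icc 0 t, ∫ x,
        ((∑ j, ∑ k, Dst φ N ((Φ N).flow s z) x j k ^ 2) +
          ‖qfl φ N ((Φ N).flow s z) x‖ ^ 2)}) atTop (𝓝 0) :=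
    hFMR δ' hδ'0
  have hDilT : Tendsto (fun N : ℕ => localGibbsLaw σ a₀ u₀ θ₀ N (Φ N)
      {z | ∃ s ∈ Icc 0 t, ∃ x : T3, η₁ < rhoB φ N ((Φ N).flow s z) x * σ ^ 3}) atTop (𝓝 0) :=
    hDil
  have hlim : Tendsto (fun N : ℕ =>
      localGibbsLaw σ a₀ u₀ θ₀ N (Φ N)
          {z | ∃ s ∈ Icc 0 t, ∃ x : T3, η₁ < rhoB φ N ((Φ N).flow s z) x * σ ^ 3} +
        (localGibbsLaw σ a₀ u₀ θ₀ N (Φ N)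
            {z | ∃ s ∈ Icc 0 t, E₀ < ((N : ℝ) + 1)⁻¹ * configEnergy ((Φ N).flow s z)} +
          localGibbsLaw σ a₀ u₀ θ₀ N (Φ N)
            {z | δ' < ∫ s in Icc 0 t, ∫ x,
              ((∑ j, ∑ k, Dst φ N ((Φ N).flow s z) x j k ^ 2) +
                ‖qfl φ N ((Φ N).flow s z) x‖ ^ 2)})) atTop (𝓝 0) := by
    simpa only [add_zero] using hDilT.add (hEcap.add hF)
  refine tendsto_of_tendsto_of_tendsto_of_le_of_le tendsto_const_nhds hlim (fun N => zero_le)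
    fun N => ?_
  -- the union bound at fixed `N`
  have hφc : Continuous (φ N) := (hadm.1 N).continuous
  have hφ0 : ∀ y, 0 ≤ φ N y := hadm.2.1 N
  have hφ1 : ∫ y, φ N y = 1 := hadm.2.2.1 N
  have hφb : ∀ y, φ N y ≤ C * ((N : ℝ) + 1) ^ (3 * γ) := hadm.2.2.2.2.1 N
  refine measure_le_of_imp3 _ (localGibbsLaw_compl_good' (Φ N)) fun z hz hzg hw hen => ?_
  by_contra hfmr
  simp only [Set.mem_setOf_eq, not_exists, not_lt, not_and] at hw hen hfmr hz
  obtain ⟨τ, hτ, hτδ⟩ := hz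
  have hhi : ∀ s ∈ Icc 0 t, ∀ x, rhoB φ N ((Φ N).flow s z) x * σ ^ 3 ≤ η₁ := fun s hs x => hw s hs x
  have hKf := abs_Kfun_dilute_le Φ hzg hφc hφ0 hφ1 hφb hσ hK hη₁.le hε0 hCt0 hZ' hCtψ hCtχ hhi hτ
  have hEz : ((N + 1 : ℕ) : ℝ)⁻¹ * configEnergy z ≤ |E₀| := by
    have h := hen 0 ⟨le_rfl, ht.le⟩
    rw [configEnergy_orbit Φ hzg 0] at h
    rw [Nat.cast_succ]
    exact h.trans (le_abs_self E₀)
  set e := ((N + 1 : ℕ) : ℝ)⁻¹ * configEnergy z with he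
  set I := ∫ s in Icc 0 t, ∫ x, ((∑ j, ∑ k, Dst φ N ((Φ N).flow s z) x j k ^ 2) +
    ‖qfl φ N ((Φ N).flow s z) x‖ ^ 2) with hI
  have hI0 : 0 ≤ I := integral_nonneg fun s => integral_nonneg fun x => by positivity
  have he0 : 0 ≤ e := mul_nonneg (by positivity) (by unfold configEnergy; positivity)
  have hKK : Ct ≤ Kc := by rw [hKc]; linarith
  have h1 : (Ct * (12 * K * η₁ * ε) + Ct * (18 * ε * K ^ 2 * σ ^ 3 * η₁) * e) * t ≤ δ / 3 := by
    calc (Ct * (12 * K * η₁ * ε) + Ct * (18 * ε * K ^ 2 * σ ^ 3 * η₁) * e) * t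
        = Ct * ε * ((12 * K * η₁ + 18 * K ^ 2 * σ ^ 3 * η₁ * e) * t) := by ring
      _ ≤ Kc * ε * ((12 * K * η₁ + 18 * K ^ 2 * σ ^ 3 * η₁ * |E₀|) * t) := by gcongr
      _ ≤ Kc * ε * A₀ :=
          mul_le_mul_of_nonneg_left (by rw [hA₀]; linarith) (by positivity)
      _ = δ / 3 := by rw [hε]; field_simp
  have h2 : Ct * ((12 * K * η₁ + 9) / ε) * I ≤ δ / 3 := by
    calc Ct * ((12 * K * η₁ + 9) / ε) * I ≤ Kc * ((12 * K * η₁ + 9) / ε) * δ' := by gcongr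
      _ = δ / 3 := by rw [hδ']; field_simp
  linarith

end

end Summit.AtomisticToContinuum.HydrodynamicLimit.Theorems.HemisphereAffineSlaving
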